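import Literature.NumberTheory.GaloisCohomology.TateEulerCharacteristicBaseTotallyComplex
import Literature.NumberTheory.GaloisRepresentations.SUnitsCoinducedTorsionClass
import Literature.NumberTheory.GaloisRepresentations.SUnitsCoinducedLayerPresentationInstance
import HarnessLib

/-!
# Tate's global Euler–Poincaré characteristic formula at a totally complex number field
# (Milne ADT I Thm. 5.1 for `K` totally complex — the Brauer-class input `hBr` DISCHARGED)

Topic `NumberTheory/GaloisCohomology`; namespace `Literature.NumberTheory.GaloisCohomology`.  THEOREMS ONLY (no
definition, no named fact, no `sorry`, no instance, no notation; D-0026).  Lane «TATE-EPC-TC» of cell `bsd-eis`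
(crux `GoodLatticeBDPValue`, stmt-BirchSwinnertonDyer-19032): the END of the lane's kernel proof of the named fact
`tateGlobalEulerPoincareCharacteristic K` for TOTALLY COMPLEX `K`.

* `mem_torsionBy_int_iff` — `t ∈ M[n] ↔ n • t = 0` with the INTEGER-MULTIPLE spelling on the right (any `ℤ`-module
  structure; `int_smul_eq_zsmul`), the currency of the lane's `hN₂`.
* **`brauerClass_of_isTotallyComplex`** — the hypothesis `hBr` of -w6 g10's
  `TateEulerCharacteristicBaseTotallyComplex.baseK_of_brauerClass` /
  `tateGlobalEulerPoincareCharacteristic_of_isTotallyComplex_of_brauerClass`, VERBATIM, now PROVED: for every finite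
  `S ⊇ S_p`, open `H ≥ N_S`, Galois layer `E/K̄^H` inside `K_S` and additive invariant `ψ`, the `Δ`-stable
  `N₂ := 𝓗²(E_S)[p] = Submodule.torsionBy ℤ _ p` satisfies `ψ(𝓗²(E_S)[p]) + ψ(𝔽_p) = ψ(𝔽_p[S_f(E)])` — FILE D part 3
  (`SUnits.Layers.additive_torsion_coindOpenHRep_two_of_layerPresentation`, p702497) at -w7 g10's layer presentation
  `SUnits.Layers.layerPresentation hHo hF hS hNH` (p700981).
* **`tateGlobalEulerPoincareCharacteristic_of_isTotallyComplex`** — `tateGlobalEulerPoincareCharacteristic K` for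
  `K` totally complex: -w6 g10's `…_of_isTotallyComplex_of_brauerClass` ∘ `brauerClass_of_isTotallyComplex`; and its
  `∀`-packaged form **`forall_tateGlobalEulerPoincareCharacteristic_of_isTotallyComplex`** (the identifier the crux
  skeleton v29/v30 consumes).

HONEST FRAMING: this closes the lane's CONDITIONAL chain into an unconditional kernel theorem for totally complex `K`
(the case the crux's imaginary-quadratic base needs); number fields with a real place are NOT covered (the
archimedean terms of the lane were computed only over a totally complex base).  No statement of a Summit and no
case of BSD is proved here; 0 cells / labels / tiers move.

## References
* J. S. Milne, *Arithmetic Duality Theorems*, 2nd ed. (2006), I §5 Thm. 5.1 (pp. 67–70). [MilneADT2006]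
* J. Neukirch, A. Schmidt, K. Wingberg, *Cohomology of Number Fields*, 2nd ed. (2008), (8.7.4), (8.3.11).
  [NeukirchSchmidtWingberg2008]
* J. Tate, *Duality theorems in Galois cohomology over number fields*, Proc. ICM Stockholm 1962 (1963), Thm. 2.2.
  [Tate1963DualityICM]
-/

noncomputable section

open CategoryTheory Function
open scoped Topology

namespace Literature.NumberTheory.GaloisCohomology

open Literature.NumberTheory.GaloisRepresentations
open Literature.NumberTheory.GaloisRepresentations.OpenSubgroupLayer
open Literature.NumberTheory.GaloisRepresentations.IdeleClassBar (GalLayer)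
open Literature.NumberTheory.GaloisRepresentations.LocalWeilDatum (galFixing)
open Literature.NumberTheory.GaloisRepresentations.SUnits
open Literature.NumberTheory.GaloisRepresentations.SUnits.Layers
open Literature.NumberTheory.IwasawaTheory.Greenberg2006 (galoisGroupAbove)
open Literature.NumberTheory.NumberFields (EquivariantSUnit.sUnitsRepρ EquivariantSUnit.placesAbove)
open Literature.RepresentationTheory.FiniteGroups
open Literature.RepresentationTheory.FiniteGroups.StableLatticeReduction (torsionBy_le_comap smul_top_le_comap)
open _root_.TopRep _root_.ContRepresentation _root_.ContinuousCohomology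
open NumberField Field IsDedekindDomain Submodule
open scoped NumberField Pointwise

/-- `t ∈ M[n] ↔ n • t = 0`, the right-hand side spelled with the INTEGER MULTIPLE `n • t` of the additive group (for
any `ℤ`-module structure on `M`; `int_smul_eq_zsmul`). [cite: MilneADT2006, I §5 (p. 70, the `p`-torsion of `H²`)] -/
theorem mem_torsionBy_int_iff {M : Type*} [AddCommGroup M] [Module ℤ M] (n : ℤ) (t : M) :
    t ∈ Submodule.torsionBy ℤ M n ↔ n • t = 0 :=
  (Submodule.mem_torsionBy_iff n t).trans (Eq.to_iff (congrArg (· = (0 : M)) (int_smul_eq_zsmul _ n t)))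

/-- **The Brauer-class identity `hBr` HOLDS** (the hypothesis of `baseK_of_brauerClass` /
`tateGlobalEulerPoincareCharacteristic_of_isTotallyComplex_of_brauerClass`, verbatim): for `K` totally complex, every
finite `S ⊇ S_p`, open `H ≤ Γ_K` above `N_S`, finite Galois layer `E` of `K_S` over `K̄^H` and additive invariant `ψ`
of finite `p`-torsion `ℤ[Gal(E/K̄^H)]`-modules, the `Δ`-stable `p`-torsion `N₂ = 𝓗²(E_S)[p]` of
`𝓗²(E_S) = H²(↥U, Maps(Δ, E_S))` satisfies `ψ(𝓗²(E_S)[p]) + ψ(𝔽_p) = ψ(𝔽_p[S_f(E)])` — NSW (8.3.11) (iii) read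
equivariantly through the vector of local invariants: FILE D part 3 at the layer presentation of 𝓗².
[cite: NeukirchSchmidtWingberg2008, VIII §3 (8.3.11) (ii)/(iii)] [cite: MilneADT2006, I §5, proof of Thm. 5.1 (p. 70)]
[cite: CasselsFrohlichANT1967, Ch. VII §7.3 Cor. 7.4 (b)] -/
theorem brauerClass_of_isTotallyComplex (K : Type) [Field K] [NumberField K] [IsTotallyComplex K] :
    ∀ (S : Set (HeightOneSpectrum (𝓞 K))), S.Finite →
      ∀ (p : ℕ) [Fact p.Prime], (∀ v : HeightOneSpectrum (𝓞 K), ((p : ℕ) : 𝓞 K) ∈ v.asIdeal → v ∈ S) →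
      ∀ (H : Subgroup (absoluteGaloisGroup K)) (hHo : IsOpen (H : Set (absoluteGaloisGroup K)))
        (hNH : ramificationSubgroup K S ≤ H) (E : GalLayer K) (hF : baseField H ≤ E.1)
        (hS : ramificationSubgroup K S ≤ galFixing K E.1) [NumberField ↥(baseField H)]
        [CompactSpace ↥(galoisGroupAbove S H)]
        (ψ : ∀ ⦃X : Type⦄ ⦃_ : AddCommGroup X⦄ ⦃_ : Module ℤ X⦄,
      Representation ℤ (↥(galoisGroupAbove S H) ⧸
        ((OpenSubgroupLayer.layerSubgroup S hHo E hF hS : OpenNormalSubgroup ↥(galoisGroupAbove S H)) :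
          Subgroup ↥(galoisGroupAbove S H))) X → ℤ)
        (hψ : ∀ ⦃X Y Z : Type⦄ [AddCommGroup X] [Module ℤ X] [AddCommGroup Y] [Module ℤ Y]
      [AddCommGroup Z] [Module ℤ Z]
      (ρX : Representation ℤ (↥(galoisGroupAbove S H) ⧸
        ((OpenSubgroupLayer.layerSubgroup S hHo E hF hS : OpenNormalSubgroup ↥(galoisGroupAbove S H)) :
          Subgroup ↥(galoisGroupAbove S H))) X)
      (ρY : Representation ℤ (↥(galoisGroupAbove S H) ⧸
        ((OpenSubgroupLayer.layerSubgroup S hHo E hF hS : OpenNormalSubgroup ↥(galoisGroupAbove S H)) :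
          Subgroup ↥(galoisGroupAbove S H))) Y)
      (ρZ : Representation ℤ (↥(galoisGroupAbove S H) ⧸
        ((OpenSubgroupLayer.layerSubgroup S hHo E hF hS : OpenNormalSubgroup ↥(galoisGroupAbove S H)) :
          Subgroup ↥(galoisGroupAbove S H))) Z) (f : X →ₗ[ℤ] Y) (g : Y →ₗ[ℤ] Z),
      (∀ s x, f (ρX s x) = ρY s (f x)) → (∀ s y, g (ρY s y) = ρZ s (g y)) →
      Injective f → Surjective g → LinearMap.range f = LinearMap.ker g → Finite Y →
      (∀ y : Y, (p : ℤ) • y = 0) → ψ ρY = ψ ρX + ψ ρZ),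
        ∃ (N₂ : Submodule ℤ (continuousCohomology 2 ((resRep K S H).coindOpen
      ((OpenSubgroupLayer.layerSubgroup S hHo E hF hS : OpenNormalSubgroup ↥(galoisGroupAbove S H)) :
        Subgroup ↥(galoisGroupAbove S H)) (OpenSubgroupLayer.layerSubgroup S hHo E hF hS).isOpen').toTopRep))
          (hN₂st : ∀ c, N₂ ≤ N₂.comap ((resRep K S H).coindOpenHRep
      ((OpenSubgroupLayer.layerSubgroup S hHo E hF hS : OpenNormalSubgroup ↥(galoisGroupAbove S H)) :
        Subgroup ↥(galoisGroupAbove S H)) (OpenSubgroupLayer.layerSubgroup S hHo E hF hS).isOpen' 2 c)),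
          (∀ t, t ∈ N₂ ↔ (p : ℤ) • t = 0) ∧
          (ψ (((resRep K S H).coindOpenHRep
        ((OpenSubgroupLayer.layerSubgroup S hHo E hF hS : OpenNormalSubgroup ↥(galoisGroupAbove S H)) :
          Subgroup ↥(galoisGroupAbove S H)) (OpenSubgroupLayer.layerSubgroup S hHo E hF hS).isOpen' 2).subrepresentation
          N₂ hN₂st) +
      ψ ((Representation.trivial ℤ (↥(galoisGroupAbove S H) ⧸
        ((OpenSubgroupLayer.layerSubgroup S hHo E hF hS : OpenNormalSubgroup ↥(galoisGroupAbove S H)) :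
          Subgroup ↥(galoisGroupAbove S H))) ℤ).quotient ((p : ℤ) • ⊤) (smul_top_le_comap _ (p : ℤ))) =
      (letI := algOfLE hF; haveI := isScalarTower_algOfLE (K := K) hF; haveI := E.numberField;
        ψ (Representation.quotient ((Representation.ofMulAction ℤ (↥E.1 ≃ₐ[↥(baseField H)] ↥E.1)
          (EquivariantSUnit.placesAbove K S ↥(baseField H) ↥E.1)).comp
          (OpenSubgroupLayer.layerEquiv S hHo E hF hS).toMonoidHom) ((p : ℤ) • ⊤) (smul_top_le_comap _ (p : ℤ))))) := by
  intro S hS p _ hSp H hHo hNH E hF hS' _ _ ψ hψ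
  exact ⟨_, torsionBy_le_comap _ (p : ℤ), mem_torsionBy_int_iff (p : ℤ),
    additive_torsion_coindOpenHRep_two_of_layerPresentation hHo hNH hS E hF hS' hSp (layerPresentation hHo hF hS' hNH)
      ψ hψ _ (mem_torsionBy_int_iff (p : ℤ)) _⟩

/-- **Tate's global Euler–Poincaré characteristic formula (Milne ADT I Thm. 5.1; Tate ICM 1962 Thm. 2.2;
NSW (8.7.4)) at a TOTALLY COMPLEX number field `K`** — the named fact `tateGlobalEulerPoincareCharacteristic K`,
unconditionally: -w6 g10's `tateGlobalEulerPoincareCharacteristic_of_isTotallyComplex_of_brauerClass` (B9 reduction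
to the prime-to-`p` base case ∘ B1c finiteness at totally complex fields ∘ the ADAPTER ∘ the Kummer class identity)
fed with `brauerClass_of_isTotallyComplex`.  Fields with a real place are not covered.
[cite: MilneADT2006, I §5 Thm. 5.1 (pp. 67–70)] [cite: Tate1963DualityICM, Thm. 2.2] [cite: NeukirchSchmidtWingberg2008, (8.7.4)] -/
theorem tateGlobalEulerPoincareCharacteristic_of_isTotallyComplex (K : Type) [Field K] [NumberField K]
    [IsTotallyComplex K] : tateGlobalEulerPoincareCharacteristic K :=
  tateGlobalEulerPoincareCharacteristic_of_isTotallyComplex_of_brauerClass K (brauerClass_of_isTotallyComplex K)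

/-- **`∀`-packaged form** of `tateGlobalEulerPoincareCharacteristic_of_isTotallyComplex` — the token shape
`∀ (L : Type) [Field L] [NumberField L] [IsTotallyComplex L], tateGlobalEulerPoincareCharacteristic L` consumed BY NAME by
the line `halves` of crux `GoodLatticeBDPValue` (skeleton v29/v30 `publishedFactsGreenberg_v29`, replacing v28's stub 4
conjunct 2). [cite: MilneADT2006, I §5 Thm. 5.1 (p. 67)] [cite: Tate1963DualityICM, Thm. 2.2] -/
theorem forall_tateGlobalEulerPoincareCharacteristic_of_isTotallyComplex :
    ∀ (L : Type) [Field L] [NumberField L] [IsTotallyComplex L], tateGlobalEulerPoincareCharacteristic L :=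
  fun L _ _ _ => tateGlobalEulerPoincareCharacteristic_of_isTotallyComplex L

end Literature.NumberTheory.GaloisCohomology

end
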